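import Literature.AlgebraicGeometry.Motives.AbelianVarietyQuasiSectionPerfectField
import Literature.AlgebraicGeometry.Motives.TateAbelianFiniteSteps
import HarnessLib

/-!
# Epimorphisms of abelian varieties: quasi-sections, surjectivity, and surjectivity on `V_ℓ`

Topic `AlgebraicGeometry/Motives`, namespace `Literature.AlgebraicGeometry.Motives.AbelianVariety`.
THEOREMS ONLY (no definition, no named fact, no instance, no `sorry`).

For a homomorphism `f : A ⟶ B` of abelian varieties over a PERFECT field `K` which is an EPIMORPHISM of the
category `AbelianVariety K` (the categorical notion, as produced by universal properties — e.g. the Albanese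
functoriality maps `Alb_u` of [Liu2021, Def. 2.3], which the tree proves epimorphic from the uniqueness half of the
Albanese universal property, `Liu2021/NablaMapSurjectiveOfPieces.lean`):

* `exists_quasiSection_of_epi` — there are `s : B ⟶ A` and `N ≠ 0` with `s ≫ f = N • 𝟙 B` (Mumford §19, Remark
  p. 169 / Thm. 1 p. 173; Milne 1986, Prop. 12.1).  PROOF: let `A ↠ im f ↪ B` be the image factorisation
  (`toImage`, `imageι`, `Motives/AbelianVarietyImage`) and take a Poincaré complement of the abelian subvariety
  `im f ↪ B` over the perfect field `K` with its two-sided quasi-inverse `(h, t)` (`exists_complement_of_perfectField`):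
  `f ≫ t = toImage f ≫ (imageι f ≫ t) = 0`, so `t = 0` because `f` is an epimorphism, whence
  `h ≫ imageι f = N • 𝟙 B`; compose with a quasi-section of the surjective `toImage f`
  (`exists_quasiSection_of_perfectField`).
* `surjective_toSchemeHom_of_epi` — `f` is surjective on underlying schemes (`[N]_B` is an isogeny, hence
  surjective: `isIsogeny_zsmul_id_holds`, Mumford §6 App. 3 / §8), the converse of the tree's
  `epi_of_surjective_toSchemeHom` (`Motives/AbelianVarietyPoincareSplitting`).
* `rationalTateModuleMap_nsmul_id` — `V_ℓ([N]_A) = N · id` (functoriality and additivity of `V_ℓ`, Mumford §19 p. 172).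
* `surjective_rationalTateModuleMap_of_epi` — `V_ℓ(f) : V_ℓ A → V_ℓ B` is surjective (`V_ℓ(s) ≫ V_ℓ(f) = N · id` with
  `N` invertible in `ℚ_ℓ`), and
* **`injective_dualMap_rationalTateModuleMap_of_epi`** — the dual map `ᵗV_ℓ(f) : V_ℓ(B)^∨ → V_ℓ(A)^∨` (the étale
  `H¹`-pull-back in the shape of `Liu2021/AppendixC/EtaleH1Tower.lean`) is injective (Mathlib
  `LinearMap.dualMap_injective_of_surjective`).

Use (cell `hodgecm-mathlib`, GS programme, census `A-provers/A-p01/CENSUS-GS4-reldim1-inputs.A-p01g4.md` F-a): the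
hypothesis `hI : ∀ f, Injective (rationalTateModuleMap ℓ (C.Atr f)).dualMap` of
`Sec42Data.HeckeTranslates.etaleHeckeDatumOfTranslates` (`Liu2021/AppendixC/EtaleHeckeDatumOfTranslates.lean`) for a
tower whose `Alb_u` are epimorphisms (`Sec42Data.epi_Atr_of_pieces_lift`), without a Betti pinning.  Banked generic
leaf (books 0); HC_CM is proved only modulo the 7 printed citations until rung 0 closes.

## References
* [MumfordAV1970] D. Mumford, *Abelian Varieties* (1970): §6 Application 3 (p. 64), §19 Thm. 1 and Remark p. 169,
  p. 172 (`V_ℓ f`).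
* [Milne1986AbelianVarieties] J. S. Milne, *Abelian Varieties*, in Cornell–Silverman (1986), Prop. 12.1 (p. 122).
* [Liu2021] Y. Liu, *Fourier–Jacobi cycles and arithmetic relative trace formula*, Camb. J. Math. 9 (2021), Def. 2.3,
  §4.3 (FJcycle.tex l. 2154–2160).
-/

set_option autoImplicit false

noncomputable section

universe u

open CategoryTheory CategoryTheory.Limits AlgebraicGeometry

namespace Literature.AlgebraicGeometry.Motives

namespace AbelianVariety

variable {K : Type u} [Field K]

/-! ### §1 `V_ℓ([N]) = N` -/

/-- **`V_ℓ([N]_A) = N · id`** on the rational Tate module (additivity `rationalTateModuleMap_add` and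
`rationalTateModuleMap_id`). [cite: MumfordAV1970, §19 (p. 172, `V_ℓ f`)] -/
theorem rationalTateModuleMap_nsmul_id (ℓ : ℕ) [Fact ℓ.Prime] (A : AbelianVariety K) (N : ℕ) :
    rationalTateModuleMap ℓ (N • 𝟙 A) = N • (LinearMap.id : A.rationalTateModule ℓ →ₗ[ℚ_[ℓ]] _) := by
  induction N with
  | zero => rw [zero_smul, zero_smul, rationalTateModuleMap_zero]
  | succ n ih => rw [succ_nsmul, rationalTateModuleMap_add, ih, rationalTateModuleMap_id, succ_nsmul]

/-- `V_ℓ(g) ∘ V_ℓ(s) = N · id` whenever `s ≫ g = N • 𝟙`. [cite: MumfordAV1970, §19 (p. 172)] -/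
theorem rationalTateModuleMap_comp_of_comp_eq_nsmul (ℓ : ℕ) [Fact ℓ.Prime] {A B : AbelianVariety K}
    {s : B ⟶ A} {g : A ⟶ B} {N : ℕ} (h : s ≫ g = N • 𝟙 B) :
    (rationalTateModuleMap ℓ g).comp (rationalTateModuleMap ℓ s) =
      N • (LinearMap.id : B.rationalTateModule ℓ →ₗ[ℚ_[ℓ]] _) := by
  rw [← rationalTateModuleMap_comp, h, rationalTateModuleMap_nsmul_id]

/-- A linear map `g` with `g ∘ s = N · id`, `N ≠ 0`, over `ℚ_ℓ` is surjective (linear-algebra plumbing). [folklore] -/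
private theorem surjective_of_comp_eq_nsmul_id (ℓ : ℕ) [Fact ℓ.Prime] {V W : Type*} [AddCommGroup V] [Module ℚ_[ℓ] V]
    [AddCommGroup W] [Module ℚ_[ℓ] W] {g : V →ₗ[ℚ_[ℓ]] W} {s : W →ₗ[ℚ_[ℓ]] V} {N : ℕ} (hN : N ≠ 0)
    (h : g.comp s = N • (LinearMap.id : W →ₗ[ℚ_[ℓ]] W)) : Function.Surjective g := by
  intro w
  refine ⟨s (((N : ℚ_[ℓ])⁻¹) • w), ?_⟩
  have hw := LinearMap.congr_fun h (((N : ℚ_[ℓ])⁻¹) • w)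
  rw [LinearMap.comp_apply] at hw
  rw [hw, LinearMap.smul_apply, LinearMap.id_apply, ← Nat.cast_smul_eq_nsmul ℚ_[ℓ], smul_smul,
    mul_inv_cancel₀ (Nat.cast_ne_zero.2 hN), one_smul]

/-! ### §2 Epimorphisms have quasi-sections (perfect ground field) -/

section PerfectField

variable [PerfectField K]

/-- **An epimorphism of abelian varieties over a perfect field has a quasi-section**: for `f : A ⟶ B` an
epimorphism of `AbelianVariety K` there are `s : B ⟶ A` and `N ≠ 0` with `s ≫ f = N • 𝟙 B`.  (Poincaré complement of
the image `im f ↪ B` with two-sided quasi-inverse `(h, t)`: `f ≫ t = 0` forces `t = 0` by the epimorphism property,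
so `h ≫ (im f ↪ B) = N • 𝟙 B`; then compose with a quasi-section of `A ↠ im f`.)
[cite: MumfordAV1970, §19 Thm. 1 (p. 173) and Remark p. 169] [cite: Milne1986AbelianVarieties, Prop. 12.1 (p. 122)] -/
theorem exists_quasiSection_of_epi {A B : AbelianVariety K} (f : A ⟶ B) [Epi f] :
    ∃ (s : B ⟶ A) (N : ℕ), N ≠ 0 ∧ s ≫ f = N • 𝟙 B := by
  -- Poincaré complement of the image abelian subvariety `imageι f : image f ⟶ B`
  obtain ⟨h, N, Z, j, t, hN, -, -, -, -, -, h₁, h₂⟩ := exists_complement_of_perfectField (imageι f)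
  -- `imageι f ≫ t = 0` (second row of `(i, j) ≫ (h, t) = N • 𝟙`)
  have hit : imageι f ≫ t = 0 := by
    have e := congrArg (fun φ => biprod.inl ≫ φ ≫ biprod.snd) h₂
    simpa only [biprod.inl_desc_assoc, Category.assoc, biprod.lift_snd, Preadditive.comp_nsmul,
      Preadditive.nsmul_comp, Category.comp_id, Category.id_comp, biprod.inl_snd, smul_zero] using e
  -- `f ≫ t = 0`, hence `t = 0` since `f` is an epimorphism
  have ht : t = 0 := by
    rw [← cancel_epi f, comp_zero, ← toImage_imageι f, Category.assoc, hit, comp_zero]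
  -- hence `h ≫ imageι f = N • 𝟙 B` (from `(h, t) ≫ (i, j) = N • 𝟙`)
  have hhi : h ≫ imageι f = N • 𝟙 B := by
    have e := h₁
    rw [ht] at e
    have hl : biprod.lift h (0 : B ⟶ Z) = h ≫ biprod.inl := by
      apply biprod.hom_ext
      · rw [biprod.lift_fst, Category.assoc, biprod.inl_fst, Category.comp_id]
      · rw [biprod.lift_snd, Category.assoc, biprod.inl_snd, comp_zero]
    rw [hl, Category.assoc, biprod.inl_desc] at e
    exact e
  -- quasi-section of the surjective `toImage f`
  obtain ⟨t', N', hN', ht'⟩ := exists_quasiSection_of_perfectField (toImage f)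
  refine ⟨h ≫ t', N' * N, mul_ne_zero hN' hN, ?_⟩
  have key : t' ≫ f = N' • imageι f := by
    calc t' ≫ f = t' ≫ (toImage f ≫ imageι f) := by rw [toImage_imageι]
      _ = (t' ≫ toImage f) ≫ imageι f := (Category.assoc _ _ _).symm
      _ = N' • imageι f := by rw [ht', Preadditive.nsmul_comp, Category.id_comp]
  rw [Category.assoc, key, Preadditive.comp_nsmul, hhi, smul_smul]

/-- **An epimorphism of abelian varieties over a perfect field is surjective** on underlying schemes — the
converse of `epi_of_surjective_toSchemeHom`.  (`s ≫ f = [N]_B` with `[N]_B` an isogeny, hence surjective.)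
[cite: MumfordAV1970, §6 Application 3 (p. 64) and §19 Remark p. 169] -/
theorem surjective_toSchemeHom_of_epi {A B : AbelianVariety K} (f : A ⟶ B) [Epi f] :
    Surjective (Hom.toSchemeHom f) := by
  obtain ⟨s, N, hN, hsf⟩ := exists_quasiSection_of_epi f
  have hiso : IsIsogeny ((N : ℤ) • 𝟙 B) := isIsogeny_zsmul_id_holds B N (Int.natCast_ne_zero.2 hN)
  have hsurj : Surjective (Hom.toSchemeHom (s ≫ f)) := by
    rw [hsf, ← natCast_zsmul]
    exact hiso.1
  have hc : Hom.toSchemeHom (s ≫ f) = Hom.toSchemeHom s ≫ Hom.toSchemeHom f := rfl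
  rw [hc] at hsurj
  exact Surjective.of_comp (Hom.toSchemeHom s) (Hom.toSchemeHom f)

/-- **`V_ℓ` of an epimorphism is surjective**: `V_ℓ(f) : V_ℓ(A) → V_ℓ(B)` is onto for `f : A ⟶ B` an epimorphism of
abelian varieties over a perfect field (`V_ℓ(s) ≫ V_ℓ(f) = N · id`, `N` invertible in `ℚ_ℓ`).
[cite: MumfordAV1970, §19 (p. 172) and Thm. 1 (p. 173)] -/
theorem surjective_rationalTateModuleMap_of_epi (ℓ : ℕ) [Fact ℓ.Prime] {A B : AbelianVariety K} (f : A ⟶ B) [Epi f] :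
    Function.Surjective (rationalTateModuleMap ℓ f) := by
  obtain ⟨s, N, hN, hsf⟩ := exists_quasiSection_of_epi f
  exact surjective_of_comp_eq_nsmul_id ℓ hN (rationalTateModuleMap_comp_of_comp_eq_nsmul ℓ hsf)

/-- **The étale `H¹`-pull-back along an epimorphism of abelian varieties is injective**: the dual map
`ᵗV_ℓ(f) : V_ℓ(B)^∨ → V_ℓ(A)^∨` of `V_ℓ(f)` is injective for `f : A ⟶ B` an epimorphism of `AbelianVariety K`, `K` perfect
(surjectivity of `V_ℓ(f)` and Mathlib `LinearMap.dualMap_injective_of_surjective`).  This is the input `hI` of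
`Sec42Data.HeckeTranslates.etaleHeckeDatumOfTranslates` for a tower with epimorphic Albanese transitions.
[cite: MumfordAV1970, §19 Thm. 1 (p. 173) and p. 172] [cite: Liu2021, §4.3 (FJcycle.tex l. 2154–2160) and Def. 2.3] -/
theorem injective_dualMap_rationalTateModuleMap_of_epi (ℓ : ℕ) [Fact ℓ.Prime] {A B : AbelianVariety K} (f : A ⟶ B)
    [Epi f] : Function.Injective (rationalTateModuleMap ℓ f).dualMap :=
  LinearMap.dualMap_injective_of_surjective (surjective_rationalTateModuleMap_of_epi ℓ f)

end PerfectField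

end AbelianVariety

end Literature.AlgebraicGeometry.Motives

end
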